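import Literature.MathematicalPhysics.QuantumFieldTheory.Balaban1983to89.Node00.N24ItemsStage13SepCoP
import Literature.MathematicalPhysics.QuantumFieldTheory.Balaban1983to89.Node00.Record13CarriersXPinnedH

/-!
# BalabanUVNodes ∕ N10 — THE K1⁵ ENGINE'S CLOSERS AT THE REPAIRED (H) X-PINNED CARRIERS OF RECORD `X' := XPinned₁₃H F N θ lam8 lam12 lam13` (dag-n05-d's [B8″H] group), v1.5 KEY: dag-n24-c's
# edition-free nodes engine `N24NodesStage13FourPinPointedCoP.N24_nodes₁₃CoP_rebindX_fourPin_pointed` (key `Provisos₁₃Core`, record `IsRecordOfRecord₁₃CCoP`) and its v1.5 item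
# layer `N24ItemsStage13SepCoP` (K1⁵'s θ-keyed consequent and the rung-2 body at `Provisos₁₃SepCoP` ∕ `IsRecordOfRecord₁₃CSepCoP`) BY NAME, with the three X-reading sockets —
# N05 `h05`, N09 `h09`, N10 `h10` — READ AS THE THREE LEAVES OF RECORD at `(lam8, lam12, lam13)` and every other socket θ-keyed; plus the REGISTERED RUNG-1 BODY of
# `K1Skeleton13SepCoP` at the H-pinned parameter `θ.pinX3H` — the H edition of this seat's `…N10XPinnedClosers13SepCoP` (p526134) (Track A, DAG node N10 [B13] ∕ binder N24; strategy s2; seat `pub-ymgap-dag-n10-d` g8; composite, count-neutral)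

WHY THE H EDITION (dag-ref-A g18 READ-25 on dag-n05-d's p522653 `…N05XPinVacuity`, VACUITY-CERTIFIED): the N05 socket of the engine at this seat's `XPinned₁₃` (p497764; [B8″]
group `withB8OfRecordSubB`) is UNSERVABLE AS TYPED at D ≥ 2 — any «N05 via pinX3» reading holds ex falso; the one-token repair `withB8OfRecordSubB ↦ withB8OfRecordSubBH` is dag-n05-d g6's
`Node00/Record13CarriersXPinnedH` (p526413 ✓ 11:08Z: `XPinned₁₃H`, `Stage13Params.pinX3H := θ.rebindX (XPinned₁₃H …)`, `socket05∕09∕10_pinX3H_iff : Iff.rfl` — N05's typed socket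
there = the [B8″H] leaf form over the REPAIRED members `famB8OfRecordSubBH`, «typed ⇒ surviving»; one declarer of the H pin = n05-d, dag-lead DEDUP-277).  THIS FILE = p526134's five
theorems at `pinX3H` (generator `tools/gen_closersH.py`: `XPinned₁₃ ↦ XPinned₁₃H`, `pinX3 ↦ pinX3H`, `socket0k_pinX3_iff ↦ socket0k_pinX3H_iff`, h05's binder text = the right-hand
side of `socket05_pinX3H_iff`); the closers read the TYPED C-binding `upOfRecord₅C` (my WORD-XPINH, bus l.19125).

HONEST FRAMING.  Count-neutral kernel bookkeeping BY NAME over LANDED modules — the v1.5 edition (director-ym №152 (β) + №160 LOCATED-7: print's background `UbgOfRecord₁₃CoP` on the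
collar, print's ζ-weights; «the LAST record edition before KEY-20»; plan g68 rev 20∕21 + dag-lead WORDS-141: K1⁵ «StabilityBAtRecordR13SepCoP» = stmt-QuantumFields-20294) of this seat's
`…N10XPinnedClosers13` (p502889, ‴) ∕ `…N10XPinnedClosers13Sep` (p509783, ⁗): dag-n24-c g5's `N24NodesStage13FourPinPointedCoP` (the thirteen nodes over the four-pin v1.5 view of
`θ.rebindX X'`, X-reading sockets at `X' P`, every other socket θ-keyed, laws `SLaw₁₃CoP ∕ TLaw₁₃CoP`; EDITION-FREE key `Provisos₁₃Core` + `IsRecordOfRecord₁₃CCoP`) and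
`N24ItemsStage13SepCoP` (item K1⁵'s θ-keyed consequent — the rev-21 text — and the rung-2 body `BetaWindowAtSomeRecord13` at `Provisos₁₃SepCoP`, plus the v1.5 record at the
re-bound view `N24_isRecordOfRecord₁₃CSepCoP_of_up_rebindX_view₁₃CoPB10YZW`), node00-def-T g15's `Node00/Record13CoP` (p520810) ∕ `Record13SepCoP` (p521293), dag-n05-d's
`Node00/Record13CarriersXPinnedH` (p526413: `XPinned₁₃H`, `Stage13Params.pinX3H`, `socket05∕09∕10_pinX3H_iff : Iff.rfl`) and this seat's `Node00/Record13CarriersCoP` (p522195: the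
v1.5 view `view₁₃CoPB10YZW`).  WHY (dag-n10-d g6 LOCATED-N24-XSOCKET, dag-lead DEDUP-251∕252 (R3)): at every K0a witness the residual
carrier family `res.X` is the degenerate `Classical.choice` one, so the engine's X-reading sockets are served ONLY at an X-pinned parameter; THIS FILE TAKES `X' :=` THE REPAIRED CARRIERS
OF RECORD and reads the three sockets as the three nodes' LEAVES: N05 ← dag-n05-d's typed [B8″H] leaf form at `lam8` (surviving, not the vacuous [B8″] one), N09 ← `B12Sec2to5.Lemma4Printed (F12OfRecord₁₂ F N θ.toStage12Params
lam12 P) (lam12 P).consts`, N10 ← `B13LeafOfRecord θ₃ (lam13 P)` (node00-def-B13's group of record; this seat's junctions `b13LeafOfRecord_of_located(_termwise ∕ _walks …)` conclude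
exactly it).  Every §1 proof is ONE application of the engine at `X' := XPinned₁₃H F N θ lam8 lam12 lam13` with `h05 ∕ h09 := (socket0k_pinX3H_iff …).2 (h0k P)` and
`h10 := fun P _ _ _ _ => (socket10_pinX3H_iff …).2 (h10 P)`; §1 generated from the engine's text by this seat's `tools/gen_closersH.py`.  COMPOSITE: every
socket is a hypothesis (the three leaves included); `hP` DISPLAYED (K0⁵ «Record13SepCoPInhabited», stmt-QuantumFields-20293 — no `.bg` consumer here); nothing discharged; NOT
`stub_nodes13P` ∕ `stub_betaWindow13P`; nothing of Bałaban's asserted; N05 ∕ N09 ∕ N10 ∕ N24 NOT discharged; no count moves (typed 28∕28 · discharged 5∕27); one finite four-torus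
programme at fixed ε per run; nothing continuum ∕ ℝ⁴ ∕ OS ∕ mass-gap ∕ Clay.  0 `sorry`, 0 `def`, 0 `instance`, 0 `notation`, standard axioms.  Filed `--kind proof --supports` K1⁵
«StabilityBAtRecordR13SepCoP» (stmt-QuantumFields-20294) `--as helper` of route «BalabanUVNodes» (dag-lead WORDS-141).

WHAT THIS FILE PROVES.  §1 (θ-generic, at `pinX3H`) `nodes₁₃CoP_pinX3H_of_leaves` (edition-free key), ★ `stabilityBR13SepCoP_thetaShape20_pinX3H_of_leaves` (K1⁵'s consequent
witnessed by `(θ, hP)`), `betaWindowAtSomeRecord₁₃SepCoP_pinX3H_of_leaves_of_boxH`; §2 ★★ `nodesAtSomeRecord₁₃SepCoPP_pinX3H_of_leaves` — the BODY of the registered rung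
`K1Skeleton13SepCoP.NodesAtSomeRecord13P` (general `N`) witnessed by `(θ, hP, w)` with N05 read at the SURVIVING [B8″H] leaf — and ★★ `nodesAtSomeRecord₁₃SepCoPP_allPinnedH_of_leaves`.
-/

noncomputable section

namespace Summit.QuantumFields.YangMills.BalabanUVNodes.N10XPinnedHClosers13SepCoP

open Literature.MathematicalPhysics.QuantumFieldTheory.Balaban1983to89
open Literature.MathematicalPhysics.QuantumFieldTheory.Balaban1983to89.T4Continuum
open Literature.MathematicalPhysics.QuantumFieldTheory.Balaban1983to89.T4DatumAssembly
open Literature.MathematicalPhysics.QuantumFieldTheory.Balaban1983to89.DagBinding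
open Literature.MathematicalPhysics.QuantumFieldTheory.Balaban1983to89.FlowStepRuns
open Literature.MathematicalPhysics.QuantumFieldTheory.Balaban1983to89.AveragingRT
open Literature.MathematicalPhysics.QuantumFieldTheory.Balaban1983to89.FlowStep (BetaLowerH BetaUpperH)
open Literature.MathematicalPhysics.QuantumFieldTheory.Balaban1983to89.B8IdxB8LawsB (IdxB8SubB famB8OfRecordSubB)
open Literature.MathematicalPhysics.QuantumFieldTheory.Balaban1983to89.Node00
open scoped Matrix.Norms.L2Operator

variable {F : T4Family} {N : ℕ} [NeZero N]

/-! ## §1. θ-generic: the v1.5 engine at `X' := XPinned₁₃H F N θ lam8 lam12 lam13`, the three X-sockets ← the three leaves of record (N05's = the surviving [B8″H] form) -/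
/-- **THE THIRTEEN DAG NODES AT A WORLD BOUND TO THE FOUR-PIN v1.5 VIEW OF THE X-PINNED PARAMETER `θ.pinX3H lam8 lam12 lam13`, EDITION-FREE KEY (`hP : θ.Provisos₁₃Core`, record
`IsRecordOfRecord₁₃CCoP` at θ's own `datumOfRecord₁₃CoP`): THE THREE X-READING CHILDREN ← THEIR LEAVES OF RECORD, EVERY OTHER SOCKET θ-KEYED** — dag-n24-c's
`N24_nodes₁₃CoP_rebindX_fourPin_pointed` (`N24NodesStage13FourPinPointedCoP`) at `X' := XPinned₁₃H F N θ lam8 lam12 lam13` with `h05 ∕ h09 ∕ h10` supplied through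
`socket05∕09∕10_pinX3H_iff` from dag-n05-d's SURVIVING [B8″H] leaf form at `lam8`, Lemma 4 at the [B12] frame of record at `lam12`, and `B13LeafOfRecord θ₃ (lam13 P)`; `hup` over this seat's v1.5 view
`(θ.pinX3H …).view₁₃CoPB10YZW …` (`Record13CarriersCoP`), laws at print's background and ζ-weights `SLaw₁₃CoP ∕ TLaw₁₃CoP`.  COMPOSITE; nothing discharged. [cite: Balaban1985RegularSpaces, Thm 2 p.83; Balaban1987RG1, Lemma 4 p.280, Thm 1 p.259, Thm 3 p.264, (1.22) p.264, (2.9) p.266; Balaban1988RG2Cluster, Lemmas 1–3 pp.9, 11, 20; Balaban1989LargeFieldII, Thm 1 p.355, (0.1) pp.355–356, p.391; Balaban1985UV3, Thm 1 p.257 + Thm 2 p.272; Balaban1985BackgroundPropagators, Thm 3.1 p.397; Balaban1985Variational, Thm 1 p.279, (1)–(7) pp.277–278; Balaban1988Convergent, Thm 1 p.262, (1.7)–(1.12) pp.246–248, (2.18) p.257, (2.28) p.259, Cor. 3 (2.50) p.264, (3.16)–(3.22) pp.268–269; Balaban1989LargeFieldI, Prop. 1 p.194, (0.2)–(0.4)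 p.176 (bookkeeping)] -/
theorem nodes₁₃CoP_pinX3H_of_leaves (θ : Stage13Params F N) (hP : θ.Provisos₁₃Core F N) (hθ : θ.Admissible F N)
    (lam8 : ResidB8 θ.toStage3Params) (lam12 : ResidB12 F N θ.τ9.M) (lam13 : B12.RunParams → ResidB13 θ.toStage3Params) (Mstar : ℕ) (ops : OpsY N θ.toStage3Params Mstar) (ζ : ResidZ F N)
    (lamW : ResidW F N) (w : WorldP) (hC : w.C = (datumOfRecord₁₃CoP F N θ hP).C) (hγ : 0 < w.γ ∧ w.γ ≤ θ.γ) (hL : w.L = (θ.L : ℝ))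
    (hup : ∀ P, w.up P = upOfRecord₅C F N ((θ.pinX3H F N lam8 lam12 lam13).view₁₃CoPB10YZW F N Mstar ops ζ lamW) P)
    (h05 : ∀ P : B12.RunParams, B8LeafR θ.D (θ.L : ℝ) lam8.C₂ lam8.B₁' lam8.inp.B₀' lam8.B₁ lam8.B₂ lam8.c₁ lam8.inp lam8.B₀β
      (B8Lemma1NonAbelian.blockPairNA θ.D θ.L θ.𝔸) (fun j : IdxB8SubB θ.toStage3Params => famB8OfRecordSubBH θ.toStage3Params lam8.β lam8.len j)
      lam8.lan lam8.cub (fun j => lam8.toAxial j.1))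
    (h06 : B9LeafX (Y9OfRecord N θ.toStage3Params Mstar ops)) (h07 : B11Leaf (Z11OfRecord F N ζ)) (h08 : PrintedUV3V N θ.L)
    (h09 : ∀ P : B12.RunParams, B12Sec2to5.Lemma4Printed (F12OfRecord₁₂ F N θ.toStage12Params lam12 P) (lam12 P).consts)
    (h09T : ∀ P : B12.RunParams, (leavesP w P).smallCouplings → (leavesP w P).smallFieldInductive) (h10 : ∀ P : B12.RunParams, B13LeafOfRecord θ.toStage3Params (lam13 P))
    (h11 : ∀ P : B12.RunParams, (leavesP w P).b7 → (leavesP w P).b8 → (leavesP w P).b9 → (leavesP w P).b10 → (leavesP w P).b11 →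
      (leavesP w P).smallCouplings → (leavesP w P).smallFieldInductive → (leavesP w P).flowControl →
        ∀ k, k < P.K → SLaw₁₃CoP F N θ P k → TLaw₁₃CoP F N θ P k)
    (h12 : ∀ P : B12.RunParams, B15Leaf (WOfRecord₁₃ F N θ lamW P)) (hR : ∀ (P : B12.RunParams) (k : ℕ), k < P.K → TLaw₁₃CoP F N θ P k → SLaw₁₃CoP F N θ P (k + 1))
    (hUV : ∀ P : B12.RunParams, (genFlow (betaOfRecord₁₃ F N θ) P.g0).InInterval w.γ P.K → ∀ k, k ≤ P.K → SLaw₁₃CoP F N θ P k →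
      ∀ U : GaugeField (F.P P.K) k (SU N),
        chiβOfRecord₁₃ F N θ P.K (gOfRecord₁₃ F N θ P) k U *
              Real.exp (-(1 / (gOfRecord₁₃ F N θ P k) ^ 2 * wilsonBGOfRecord F N θ.εbg P k U)
                - w.em (gOfRecord₁₃ F N θ P k) * (Fintype.card (Site (F.P P.K) k) : ℝ)) ≤ densOfRecord₁₃ F N θ P k U ∧
        densOfRecord₁₃ F N θ P k U ≤ Real.exp (w.ep (gOfRecord₁₃ F N θ P k) * (Fintype.card (Site (F.P P.K) k) : ℝ))) :
    IsRecordOfRecord₁₃CCoP F N (datumOfRecord₁₃CoP F N θ hP) w ∧ ∀ P : B12.RunParams, Nodes (leavesP w P) :=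
  N24_nodes₁₃CoP_rebindX_fourPin_pointed θ hP hθ (XPinned₁₃H F N θ lam8 lam12 lam13) Mstar ops ζ lamW w hC hγ hL hup (fun P => (socket05_pinX3H_iff F N θ lam8 lam12 lam13 P).2 (h05 P)) h06 h07
    h08 (fun P => (socket09_pinX3H_iff F N θ lam8 lam12 lam13 P).2 (h09 P)) h09T (fun P _ _ _ _ => (socket10_pinX3H_iff F N θ lam8 lam12 lam13 P).2 (h10 P)) h11 h12 hR hUV

/-- **★ ITEM K1⁵'s θ-KEYED CONSEQUENT (the rev-21 text of «StabilityBAtRecordR13SepCoP», stmt-QuantumFields-20294) WITNESSED BY `(θ, hP)`, CHILDREN OVER THE FOUR-PIN v1.5 VIEW OF THE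
X-PINNED PARAMETER, N05 ∕ N09 ∕ N10 ← THEIR LEAVES OF RECORD** (dag-n24-c's `N24_stabilityBR13SepCoP_thetaShape20_rebindX_fourPin_pointed` (`N24ItemsStage13SepCoP`) at
`X' := XPinned₁₃H F N θ lam8 lam12 lam13`; guard `hU`, `hP : Provisos₁₃SepCoP` (K0⁵ «Record13SepCoPInhabited», stmt-QuantumFields-20293), admissibility, the nine carrier-blind sockets and the
β-box pair displayed θ-keyed).  COMPOSITE; NOT the stub. [cite: Balaban1989LargeFieldII, Thm 1 p.355, (0.1) pp.355–356, p.391; Balaban1988Convergent, (1.7)–(1.12) pp.246–248, (2.18) p.257, (2.28) p.259, (3.16)–(3.22) pp.268–269; Balaban1985Variational, (1)–(7) pp.277–278; Balaban1987RG1, Thm 3 p.264, (0.17)–(0.21) pp.255–256 and (1.22) p.264, (2.9) p.266; Balaban1985RegularSpaces, Thm 2 p.83; Balaban1987RG1, Lemma 4 p.280; Balaban1988RG2Cluster, Lemmas 1–3 pp.9–20; Balaban1985UV3, Thm 1 p.257 (bookkeeping + elementary window)] -/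
theorem stabilityBR13SepCoP_thetaShape20_pinX3H_of_leaves (θ : Stage13Params F N) (hP : θ.Provisos₁₃SepCoP F N) (hθ : θ.Admissible F N) (hU : θ.ZtUnity F N ∧ θ.SlotsNondegenerate₁₃ F N)
    (lam8 : ResidB8 θ.toStage3Params) (lam12 : ResidB12 F N θ.τ9.M) (lam13 : B12.RunParams → ResidB13 θ.toStage3Params) (Mstar : ℕ) (ops : OpsY N θ.toStage3Params Mstar) (ζ : ResidZ F N)
    (lamW : ResidW F N) (w : WorldP) (hC : w.C = (datumOfRecord₁₃SepCoP F N θ hP).C) (hγ : 0 < w.γ ∧ w.γ ≤ θ.γ) (hL : w.L = (θ.L : ℝ))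
    (hup : ∀ P, w.up P = upOfRecord₅C F N ((θ.pinX3H F N lam8 lam12 lam13).view₁₃CoPB10YZW F N Mstar ops ζ lamW) P)
    (h05 : ∀ P : B12.RunParams, B8LeafR θ.D (θ.L : ℝ) lam8.C₂ lam8.B₁' lam8.inp.B₀' lam8.B₁ lam8.B₂ lam8.c₁ lam8.inp lam8.B₀β
      (B8Lemma1NonAbelian.blockPairNA θ.D θ.L θ.𝔸) (fun j : IdxB8SubB θ.toStage3Params => famB8OfRecordSubBH θ.toStage3Params lam8.β lam8.len j)
      lam8.lan lam8.cub (fun j => lam8.toAxial j.1))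
    (h06 : B9LeafX (Y9OfRecord N θ.toStage3Params Mstar ops)) (h07 : B11Leaf (Z11OfRecord F N ζ)) (h08 : PrintedUV3V N θ.L)
    (h09 : ∀ P : B12.RunParams, B12Sec2to5.Lemma4Printed (F12OfRecord₁₂ F N θ.toStage12Params lam12 P) (lam12 P).consts)
    (h09T : ∀ P : B12.RunParams, (leavesP w P).smallCouplings → (leavesP w P).smallFieldInductive) (h10 : ∀ P : B12.RunParams, B13LeafOfRecord θ.toStage3Params (lam13 P))
    (h11 : ∀ P : B12.RunParams, (leavesP w P).b7 → (leavesP w P).b8 → (leavesP w P).b9 → (leavesP w P).b10 → (leavesP w P).b11 →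
      (leavesP w P).smallCouplings → (leavesP w P).smallFieldInductive → (leavesP w P).flowControl →
        ∀ k, k < P.K → SLaw₁₃CoP F N θ P k → TLaw₁₃CoP F N θ P k)
    (h12 : ∀ P : B12.RunParams, B15Leaf (WOfRecord₁₃ F N θ lamW P)) (hR : ∀ (P : B12.RunParams) (k : ℕ), k < P.K → TLaw₁₃CoP F N θ P k → SLaw₁₃CoP F N θ P (k + 1))
    (hUV : ∀ P : B12.RunParams, (genFlow (betaOfRecord₁₃ F N θ) P.g0).InInterval w.γ P.K → ∀ k, k ≤ P.K → SLaw₁₃CoP F N θ P k →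
      ∀ U : GaugeField (F.P P.K) k (SU N),
        chiβOfRecord₁₃ F N θ P.K (gOfRecord₁₃ F N θ P) k U *
              Real.exp (-(1 / (gOfRecord₁₃ F N θ P k) ^ 2 * wilsonBGOfRecord F N θ.εbg P k U)
                - w.em (gOfRecord₁₃ F N θ P k) * (Fintype.card (Site (F.P P.K) k) : ℝ)) ≤ densOfRecord₁₃ F N θ P k U ∧
        densOfRecord₁₃ F N θ P k U ≤ Real.exp (w.ep (gOfRecord₁₃ F N θ P k) * (Fintype.card (Site (F.P P.K) k) : ℝ)))
    (hlo : BetaLowerH w.b w.γ (datumOfRecord₁₃SepCoP F N θ hP).βfun) (hhi : BetaUpperH w.βup w.γ (datumOfRecord₁₃SepCoP F N θ hP).βfun) :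
    ∃ (θ' : Stage13Params F N) (h' : θ'.Provisos₁₃SepCoP F N), (θ'.ZtUnity F N ∧ θ'.SlotsNondegenerate₁₃ F N) ∧ θ'.Admissible F N ∧
      B16.EndStatementBPrinted (datumOfRecord₁₃SepCoP F N θ' h').C ∧
      ∃ γ₁ : ℝ, 0 < γ₁ ∧ ∀ γ : ℝ, 0 < γ → γ ≤ γ₁ → ∃ P : B12.RunParams, 1 ≤ P.K ∧ ((datumOfRecord₁₃SepCoP F N θ' h').C P).flow.InInterval γ P.K :=
  N24_stabilityBR13SepCoP_thetaShape20_rebindX_fourPin_pointed θ hP hθ hU (XPinned₁₃H F N θ lam8 lam12 lam13) Mstar ops ζ lamW w hC hγ hL hup (fun P => (socket05_pinX3H_iff F N θ lam8 lam12 lam13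
    P).2 (h05 P)) h06 h07 h08 (fun P => (socket09_pinX3H_iff F N θ lam8 lam12 lam13 P).2 (h09 P)) h09T (fun P _ _ _ _ => (socket10_pinX3H_iff F N θ lam8 lam12 lam13 P).2 (h10 P)) h11 h12 hR hUV
    hlo hhi

/-- **THE ∃-BODY OF THE rev-21 RUNG `BetaWindowAtSomeRecord13` (`K1Skeleton13SepCoP`) WITNESSED BY `(θ, hP, w)` OVER THE FOUR-PIN v1.5 VIEW OF THE X-PINNED PARAMETER, N05 ∕ N09 ∕
N10 ← THEIR LEAVES OF RECORD** (dag-n24-c's `N24_betaWindowAtSomeRecord₁₃SepCoP_of_rebindX_fourPin_pointed_of_boxH` at `X' := XPinned₁₃H F N θ lam8 lam12 lam13`).  COMPOSITE; NOT the stub. [cite: Balaban1989LargeFieldII, Thm 1 p.355, (0.1) pp.355–356, p.391; Balaban1988Convergent, (1.7)–(1.12) pp.246–248, (2.18) p.257, (2.28) p.259, (3.16)–(3.22) pp.268–269; Balaban1985Variational, (1)–(7) pp.277–278; Balaban1987RG1, Thm 3 p.264, (0.17)–(0.21) pp.255–256 and (1.22) p.264, (2.9) p.266; Balaban1985RegularSpaces,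 Thm 2 p.83; Balaban1987RG1, Lemma 4 p.280; Balaban1988RG2Cluster, Lemmas 1–3 pp.9–20; Balaban1985UV3, Thm 1 p.257 (bookkeeping + elementary window)] -/
theorem betaWindowAtSomeRecord₁₃SepCoP_pinX3H_of_leaves_of_boxH (θ : Stage13Params F N) (hP : θ.Provisos₁₃SepCoP F N) (hθ : θ.Admissible F N) (hU : θ.ZtUnity F N ∧ θ.SlotsNondegenerate₁₃ F N)
    (lam8 : ResidB8 θ.toStage3Params) (lam12 : ResidB12 F N θ.τ9.M) (lam13 : B12.RunParams → ResidB13 θ.toStage3Params) (Mstar : ℕ) (ops : OpsY N θ.toStage3Params Mstar) (ζ : ResidZ F N)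
    (lamW : ResidW F N) (w : WorldP) (hC : w.C = (datumOfRecord₁₃SepCoP F N θ hP).C) (hγ : 0 < w.γ ∧ w.γ ≤ θ.γ) (hL : w.L = (θ.L : ℝ))
    (hup : ∀ P, w.up P = upOfRecord₅C F N ((θ.pinX3H F N lam8 lam12 lam13).view₁₃CoPB10YZW F N Mstar ops ζ lamW) P)
    (h05 : ∀ P : B12.RunParams, B8LeafR θ.D (θ.L : ℝ) lam8.C₂ lam8.B₁' lam8.inp.B₀' lam8.B₁ lam8.B₂ lam8.c₁ lam8.inp lam8.B₀β
      (B8Lemma1NonAbelian.blockPairNA θ.D θ.L θ.𝔸) (fun j : IdxB8SubB θ.toStage3Params => famB8OfRecordSubBH θ.toStage3Params lam8.β lam8.len j)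
      lam8.lan lam8.cub (fun j => lam8.toAxial j.1))
    (h06 : B9LeafX (Y9OfRecord N θ.toStage3Params Mstar ops)) (h07 : B11Leaf (Z11OfRecord F N ζ)) (h08 : PrintedUV3V N θ.L)
    (h09 : ∀ P : B12.RunParams, B12Sec2to5.Lemma4Printed (F12OfRecord₁₂ F N θ.toStage12Params lam12 P) (lam12 P).consts)
    (h09T : ∀ P : B12.RunParams, (leavesP w P).smallCouplings → (leavesP w P).smallFieldInductive) (h10 : ∀ P : B12.RunParams, B13LeafOfRecord θ.toStage3Params (lam13 P))
    (h11 : ∀ P : B12.RunParams, (leavesP w P).b7 → (leavesP w P).b8 → (leavesP w P).b9 → (leavesP w P).b10 → (leavesP w P).b11 →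
      (leavesP w P).smallCouplings → (leavesP w P).smallFieldInductive → (leavesP w P).flowControl →
        ∀ k, k < P.K → SLaw₁₃CoP F N θ P k → TLaw₁₃CoP F N θ P k)
    (h12 : ∀ P : B12.RunParams, B15Leaf (WOfRecord₁₃ F N θ lamW P)) (hR : ∀ (P : B12.RunParams) (k : ℕ), k < P.K → TLaw₁₃CoP F N θ P k → SLaw₁₃CoP F N θ P (k + 1))
    (hUV : ∀ P : B12.RunParams, (genFlow (betaOfRecord₁₃ F N θ) P.g0).InInterval w.γ P.K → ∀ k, k ≤ P.K → SLaw₁₃CoP F N θ P k →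
      ∀ U : GaugeField (F.P P.K) k (SU N),
        chiβOfRecord₁₃ F N θ P.K (gOfRecord₁₃ F N θ P) k U *
              Real.exp (-(1 / (gOfRecord₁₃ F N θ P k) ^ 2 * wilsonBGOfRecord F N θ.εbg P k U)
                - w.em (gOfRecord₁₃ F N θ P k) * (Fintype.card (Site (F.P P.K) k) : ℝ)) ≤ densOfRecord₁₃ F N θ P k U ∧
        densOfRecord₁₃ F N θ P k U ≤ Real.exp (w.ep (gOfRecord₁₃ F N θ P k) * (Fintype.card (Site (F.P P.K) k) : ℝ)))
    (hlo : BetaLowerH w.b w.γ (datumOfRecord₁₃SepCoP F N θ hP).βfun) (hhi : BetaUpperH w.βup w.γ (datumOfRecord₁₃SepCoP F N θ hP).βfun) :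
    ∃ (θ' : Stage13Params F N) (h' : θ'.Provisos₁₃SepCoP F N) (w' : WorldP), (θ'.ZtUnity F N ∧ θ'.SlotsNondegenerate₁₃ F N) ∧ θ'.Admissible F N ∧
      IsRecordOfRecord₁₃CSepCoP F N (datumOfRecord₁₃SepCoP F N θ' h') w' ∧ (∀ P : B12.RunParams, Nodes (leavesP w' P)) ∧
      BetaBoundsInInterval w'.C.toB12 w'.γ w'.b w'.βup ∧
      ∃ γ₁ : ℝ, 0 < γ₁ ∧ ∀ γ : ℝ, 0 < γ → γ ≤ γ₁ → ∃ P : B12.RunParams, 1 ≤ P.K ∧ ((datumOfRecord₁₃SepCoP F N θ' h').C P).flow.InInterval γ P.K :=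
  N24_betaWindowAtSomeRecord₁₃SepCoP_of_rebindX_fourPin_pointed_of_boxH θ hP hθ hU (XPinned₁₃H F N θ lam8 lam12 lam13) Mstar ops ζ lamW w hC hγ hL hup (fun P => (socket05_pinX3H_iff F N θ lam8
    lam12 lam13 P).2 (h05 P)) h06 h07 h08 (fun P => (socket09_pinX3H_iff F N θ lam8 lam12 lam13 P).2 (h09 P)) h09T (fun P _ _ _ _ => (socket10_pinX3H_iff F N θ lam8 lam12 lam13 P).2 (h10 P)) h11
    h12 hR hUV hlo hhi

/-! ## §2. The REGISTERED rung-1 body `K1Skeleton13SepCoP.NodesAtSomeRecord13P` at the H-pinned parameter (θ-generic; the `stub_nodes13P` closer shape modulo the displayed sockets) -/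
/-- **★★ THE BODY OF THE REGISTERED RUNG `K1Skeleton13SepCoP.NodesAtSomeRecord13P` (rev 21, `pub-ymgap-plan/D68-PRESS/skel20/K1Skeleton13SepCoP.lean` 9a6b8baeb65c1c65; v2 «N08 PINNED BY
NAME»; general `N`) WITNESSED BY THE K0⁵ TUPLE ITSELF `(θ, hP)` AND A WORLD BOUND TO THE FOUR-PIN v1.5 VIEW OF ITS H-PINNED PARAMETER, N05 ∕ N09 ∕ N10 ← THEIR LEAVES OF RECORD (N05 at the surviving [B8″H] form),
N08 ← the displayed `PrintedUV3V N θ.L`, EVERY OTHER SOCKET θ-KEYED** — §1's edition-free `nodes₁₃CoP_pinX3H_of_leaves` at `hP.toCore` (same datum: `datumOfRecord₁₃SepCoP θ hP` IS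
`datumOfRecord₁₃CoP θ hP.toCore`, node00-def-T's `rfl` bridge) + dag-n24-c's v1.5 record at the re-bound view `N24_isRecordOfRecord₁₃CSepCoP_of_up_rebindX_view₁₃CoPB10YZW` + the guard
`hU` + admissibility: the closer SHAPE of `stub_nodes13P` (`Inhabited13 F` hands an ARBITRARY admissible guarded `θ` with `Provisos₁₃SepCoP`; this serves that very `θ`), modulo
the thirteen displayed sockets (of which (R₁₃) `hR : TLaw₁₃CoP → SLaw₁₃CoP` is a theorem only on live re-pins).  COMPOSITE; NOT the stub; nothing discharged. [cite: Balaban1989LargeFieldII, Thm 1 p.355, (0.1) pp.355–356, p.391; Balaban1988Convergent, (1.7)–(1.12) pp.246–248, (2.18) p.257, (2.28) p.259, (3.16)–(3.22) pp.268–269; Balaban1985Variational, (1)–(7) pp.277–278; Balaban1985UV3, Thm 1 p.257 + Thm 2 p.272; Balaban1987RG1, Thm 3 p.264, (1.22) p.264, Lemma 4 p.280; Balaban1985RegularSpaces, Thm 2 p.83; Balaban1988RG2Cluster, Lemmas 1–3 pp.9–20 (bookkeeping)] -/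
theorem nodesAtSomeRecord₁₃SepCoPP_pinX3H_of_leaves (θ : Stage13Params F N) (hP : θ.Provisos₁₃SepCoP F N) (hθ : θ.Admissible F N) (hU : θ.ZtUnity F N ∧ θ.SlotsNondegenerate₁₃ F N)
    (lam8 : ResidB8 θ.toStage3Params) (lam12 : ResidB12 F N θ.τ9.M) (lam13 : B12.RunParams → ResidB13 θ.toStage3Params) (Mstar : ℕ) (ops : OpsY N θ.toStage3Params Mstar) (ζ : ResidZ F N)
    (lamW : ResidW F N) (w : WorldP) (hC : w.C = (datumOfRecord₁₃SepCoP F N θ hP).C) (hγ : 0 < w.γ ∧ w.γ ≤ θ.γ) (hL : w.L = (θ.L : ℝ))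
    (hup : ∀ P, w.up P = upOfRecord₅C F N ((θ.pinX3H F N lam8 lam12 lam13).view₁₃CoPB10YZW F N Mstar ops ζ lamW) P)
    (h05 : ∀ P : B12.RunParams, B8LeafR θ.D (θ.L : ℝ) lam8.C₂ lam8.B₁' lam8.inp.B₀' lam8.B₁ lam8.B₂ lam8.c₁ lam8.inp lam8.B₀β
      (B8Lemma1NonAbelian.blockPairNA θ.D θ.L θ.𝔸) (fun j : IdxB8SubB θ.toStage3Params => famB8OfRecordSubBH θ.toStage3Params lam8.β lam8.len j)
      lam8.lan lam8.cub (fun j => lam8.toAxial j.1))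
    (h06 : B9LeafX (Y9OfRecord N θ.toStage3Params Mstar ops)) (h07 : B11Leaf (Z11OfRecord F N ζ)) (h08 : PrintedUV3V N θ.L)
    (h09 : ∀ P : B12.RunParams, B12Sec2to5.Lemma4Printed (F12OfRecord₁₂ F N θ.toStage12Params lam12 P) (lam12 P).consts)
    (h09T : ∀ P : B12.RunParams, (leavesP w P).smallCouplings → (leavesP w P).smallFieldInductive) (h10 : ∀ P : B12.RunParams, B13LeafOfRecord θ.toStage3Params (lam13 P))
    (h11 : ∀ P : B12.RunParams, (leavesP w P).b7 → (leavesP w P).b8 → (leavesP w P).b9 → (leavesP w P).b10 → (leavesP w P).b11 →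
      (leavesP w P).smallCouplings → (leavesP w P).smallFieldInductive → (leavesP w P).flowControl →
        ∀ k, k < P.K → SLaw₁₃CoP F N θ P k → TLaw₁₃CoP F N θ P k)
    (h12 : ∀ P : B12.RunParams, B15Leaf (WOfRecord₁₃ F N θ lamW P)) (hR : ∀ (P : B12.RunParams) (k : ℕ), k < P.K → TLaw₁₃CoP F N θ P k → SLaw₁₃CoP F N θ P (k + 1))
    (hUV : ∀ P : B12.RunParams, (genFlow (betaOfRecord₁₃ F N θ) P.g0).InInterval w.γ P.K → ∀ k, k ≤ P.K → SLaw₁₃CoP F N θ P k →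
      ∀ U : GaugeField (F.P P.K) k (SU N),
        chiβOfRecord₁₃ F N θ P.K (gOfRecord₁₃ F N θ P) k U *
              Real.exp (-(1 / (gOfRecord₁₃ F N θ P k) ^ 2 * wilsonBGOfRecord F N θ.εbg P k U)
                - w.em (gOfRecord₁₃ F N θ P k) * (Fintype.card (Site (F.P P.K) k) : ℝ)) ≤ densOfRecord₁₃ F N θ P k U ∧
        densOfRecord₁₃ F N θ P k U ≤ Real.exp (w.ep (gOfRecord₁₃ F N θ P k) * (Fintype.card (Site (F.P P.K) k) : ℝ))) :
    ∃ (θ' : Stage13Params F N) (h' : θ'.Provisos₁₃SepCoP F N) (w' : WorldP), (θ'.ZtUnity F N ∧ θ'.SlotsNondegenerate₁₃ F N) ∧ θ'.Admissible F N ∧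
      IsRecordOfRecord₁₃CSepCoP F N (datumOfRecord₁₃SepCoP F N θ' h') w' ∧ (∀ P : B12.RunParams, Nodes (leavesP w' P)) ∧ PrintedUV3V N θ'.L := by
  obtain ⟨-, hn⟩ := nodes₁₃CoP_pinX3H_of_leaves θ hP.toCore hθ lam8 lam12 lam13 Mstar ops ζ lamW w hC hγ hL hup h05 h06 h07 h08 h09 h09T h10 h11 h12 hR hUV
  exact ⟨θ, hP, w, hU, hθ, N24_isRecordOfRecord₁₃CSepCoP_of_up_rebindX_view₁₃CoPB10YZW θ hP hθ (XPinned₁₃H F N θ lam8 lam12 lam13) Mstar ops ζ lamW w hC hγ hL hup, hn, h08⟩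

/-- **★★ THE SAME WITH EVERY RESIDUAL GROUP PINNED BY NAME IN THE CONCLUSION** — the rung-1 body STRENGTHENED by the world-binding conjunct over the v1.5 view with the seven
residual data ∃-bound (X = [B8″]∕[B12]∕[B13] via `Stage13Params.pinX3H`; [B9] `(Mstar', ops')`, [B11] `ζ'`, [B15] `lamW'` via `view₁₃CoPB10YZW`, whose [B10] slot stays θ's own run
family — N08 is measured by `PrintedUV3V N θ'.L`): those conjuncts of `Nodes` cannot close at an `Empty` ∕ `Classical.choice` carrier family (the all-groups form of dag-ref-G
AUDIT-A2b's cure; the rev-21 skeleton kept the v2 text, so this is a STRONGER-than-registered shape, offered for a later rung edition).  COMPOSITE; NOT the stub. [cite: Balaban1989LargeFieldII, Thm 1 p.355, (0.1) pp.355–356, p.391; Balaban1988Convergent, (1.7)–(1.12) pp.246–248, (2.18) p.257, (2.28) p.259, (3.16)–(3.22) pp.268–269; Balaban1985Variational, (1)–(7) pp.277–278; Balaban1985UV3, Thm 1 p.257 + Thm 2 p.272; Balaban1987RG1, Thm 3 p.264, (1.22) p.264, Lemma 4 p.280; Balaban1985RegularSpaces, Thm 2 p.83; Balaban1988RG2Cluster,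 Lemmas 1–3 pp.9–20 (bookkeeping)] -/
theorem nodesAtSomeRecord₁₃SepCoPP_allPinnedH_of_leaves (θ : Stage13Params F N) (hP : θ.Provisos₁₃SepCoP F N) (hθ : θ.Admissible F N) (hU : θ.ZtUnity F N ∧ θ.SlotsNondegenerate₁₃ F N)
    (lam8 : ResidB8 θ.toStage3Params) (lam12 : ResidB12 F N θ.τ9.M) (lam13 : B12.RunParams → ResidB13 θ.toStage3Params) (Mstar : ℕ) (ops : OpsY N θ.toStage3Params Mstar) (ζ : ResidZ F N)
    (lamW : ResidW F N) (w : WorldP) (hC : w.C = (datumOfRecord₁₃SepCoP F N θ hP).C) (hγ : 0 < w.γ ∧ w.γ ≤ θ.γ) (hL : w.L = (θ.L : ℝ))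
    (hup : ∀ P, w.up P = upOfRecord₅C F N ((θ.pinX3H F N lam8 lam12 lam13).view₁₃CoPB10YZW F N Mstar ops ζ lamW) P)
    (h05 : ∀ P : B12.RunParams, B8LeafR θ.D (θ.L : ℝ) lam8.C₂ lam8.B₁' lam8.inp.B₀' lam8.B₁ lam8.B₂ lam8.c₁ lam8.inp lam8.B₀β
      (B8Lemma1NonAbelian.blockPairNA θ.D θ.L θ.𝔸) (fun j : IdxB8SubB θ.toStage3Params => famB8OfRecordSubBH θ.toStage3Params lam8.β lam8.len j)
      lam8.lan lam8.cub (fun j => lam8.toAxial j.1))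
    (h06 : B9LeafX (Y9OfRecord N θ.toStage3Params Mstar ops)) (h07 : B11Leaf (Z11OfRecord F N ζ)) (h08 : PrintedUV3V N θ.L)
    (h09 : ∀ P : B12.RunParams, B12Sec2to5.Lemma4Printed (F12OfRecord₁₂ F N θ.toStage12Params lam12 P) (lam12 P).consts)
    (h09T : ∀ P : B12.RunParams, (leavesP w P).smallCouplings → (leavesP w P).smallFieldInductive) (h10 : ∀ P : B12.RunParams, B13LeafOfRecord θ.toStage3Params (lam13 P))
    (h11 : ∀ P : B12.RunParams, (leavesP w P).b7 → (leavesP w P).b8 → (leavesP w P).b9 → (leavesP w P).b10 → (leavesP w P).b11 →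
      (leavesP w P).smallCouplings → (leavesP w P).smallFieldInductive → (leavesP w P).flowControl →
        ∀ k, k < P.K → SLaw₁₃CoP F N θ P k → TLaw₁₃CoP F N θ P k)
    (h12 : ∀ P : B12.RunParams, B15Leaf (WOfRecord₁₃ F N θ lamW P)) (hR : ∀ (P : B12.RunParams) (k : ℕ), k < P.K → TLaw₁₃CoP F N θ P k → SLaw₁₃CoP F N θ P (k + 1))
    (hUV : ∀ P : B12.RunParams, (genFlow (betaOfRecord₁₃ F N θ) P.g0).InInterval w.γ P.K → ∀ k, k ≤ P.K → SLaw₁₃CoP F N θ P k →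
      ∀ U : GaugeField (F.P P.K) k (SU N),
        chiβOfRecord₁₃ F N θ P.K (gOfRecord₁₃ F N θ P) k U *
              Real.exp (-(1 / (gOfRecord₁₃ F N θ P k) ^ 2 * wilsonBGOfRecord F N θ.εbg P k U)
                - w.em (gOfRecord₁₃ F N θ P k) * (Fintype.card (Site (F.P P.K) k) : ℝ)) ≤ densOfRecord₁₃ F N θ P k U ∧
        densOfRecord₁₃ F N θ P k U ≤ Real.exp (w.ep (gOfRecord₁₃ F N θ P k) * (Fintype.card (Site (F.P P.K) k) : ℝ))) :
    ∃ (θ' : Stage13Params F N) (h' : θ'.Provisos₁₃SepCoP F N) (lam8' : ResidB8 θ'.toStage3Params) (lam12' : ResidB12 F N θ'.τ9.M)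
      (lam13' : B12.RunParams → ResidB13 θ'.toStage3Params) (Mstar' : ℕ) (ops' : OpsY N θ'.toStage3Params Mstar') (ζ' : ResidZ F N) (lamW' : ResidW F N) (w' : WorldP),
      (θ'.ZtUnity F N ∧ θ'.SlotsNondegenerate₁₃ F N) ∧ θ'.Admissible F N ∧ IsRecordOfRecord₁₃CSepCoP F N (datumOfRecord₁₃SepCoP F N θ' h') w' ∧
      (∀ P, w'.up P = upOfRecord₅C F N ((θ'.pinX3H F N lam8' lam12' lam13').view₁₃CoPB10YZW F N Mstar' ops' ζ' lamW') P) ∧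
      (∀ P : B12.RunParams, Nodes (leavesP w' P)) ∧ PrintedUV3V N θ'.L := by
  obtain ⟨-, hn⟩ := nodes₁₃CoP_pinX3H_of_leaves θ hP.toCore hθ lam8 lam12 lam13 Mstar ops ζ lamW w hC hγ hL hup h05 h06 h07 h08 h09 h09T h10 h11 h12 hR hUV
  exact ⟨θ, hP, lam8, lam12, lam13, Mstar, ops, ζ, lamW, w, hU, hθ, N24_isRecordOfRecord₁₃CSepCoP_of_up_rebindX_view₁₃CoPB10YZW θ hP hθ (XPinned₁₃H F N θ lam8 lam12 lam13) Mstar ops ζ lamW w hC hγ hL hup, hup, hn, h08⟩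

end Summit.QuantumFields.YangMills.BalabanUVNodes.N10XPinnedHClosers13SepCoP
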